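import Mathlib
import HarnessLib
import Literature.NumberTheory.Sieve.BatemanHorn
import Summits.Parity.BatemanHorn.Theorems.SystemLSDRealSegment.Negative.LoadBearing

/-!
# Crux `SystemZeroRepulsion` (stmt-Parity-11291): `pairwise_not_associated` and `irreducible` are load-bearing, modulo lattice zeros

Refuter facts (drefute gen 4, 2026-08-16; v2 adds the `irreducible` companion and factors the common engine), correcting the
standing `Disproof.lean` docblock 3(c) / `WithoutSystem` ("(X,…,X): T stays bounded iff P_x's zero statistic does; open").

Engine (`zeroFunctional_lower_of_latticeZeros`): if `S(w) = P(w²)` and `P` has a root within `1/4` of each of `−1,…,−M`,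
then `T(S) = Σ_{ρ ∈ roots S} ‖1−ρ‖⁻² ≥ Σ_{m≤M}(m + 5/4)⁻¹ ≥ (4/9)·log(M+1)`: over a root `ρ` of `P` the two square roots
`±w` satisfy `‖1−w‖² + ‖1+w‖² = 2 + 2|ρ|`, so one has `‖1∓w‖² ≤ 1 + |ρ| ≤ m + 5/4`, and distinct `m` give distinct roots.

* `pairwise_not_associated`: the pair system `(X, X)` satisfies every other Bateman–Horn clause and `s_{(X,X)} = 2·s_X`, so
  `S_x(w) = P_x(w²)` with `P_x = Σ_{n≤x} X^{s(n)}` the `f = X` polynomial (`LinearCappedRepulsion`, rank 5, proved in the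
  tree).  Hypothesis (LZ): `P_x` has, for suitable `x ≥ 2`, roots within `1/4` of `−1,…,−M` — Selberg–Delange for the
  TW-class function `z^{s(n)}` uniform on `|z| ≤ M+1` (Tenenbaum 2015 II.5–II.6, Montgomery–Vaughan 2007 §7.4: `λ` entire,
  `λ(−m) > 0`) plus Hurwitz; true for all large `x`, not yet constructible in the tree (the landed rank-5 contour engine runs
  in upper-bound mode only).  ⇒ `systemZeroRepulsion_false_without_pairwise_of_latticeZeros`.
* `irreducible`: the single member `X²` satisfies every other clause and `s_{X²}(n) = 2·ω(n)`
  (`SystemLSDRealSegment.Negative.capped_sq`), so `S_x(w) = W_x(w²)`, `W_x = Σ_{n≤x} X^{ω(n)}` (Sathe–Selberg; Selberg 1954,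
  Tenenbaum 2015 II.6 Thm 6.1: `μ` entire, `μ(−m) ≠ 0`).  Hypothesis (LZω): lattice zeros of `W_x`.
  ⇒ `systemZeroRepulsion_false_without_irreducible_of_latticeZerosOmega`.

* v3: the same engine on the ESF line stub `stub_roughZeroRepulsion` (rough polynomial at the cut `y_A(x)`): granted the rough
  lattice zeros (RLZ) of `R^X_{x,y_A(x)}` (Alladi's rough LSD law, `u = (log log x)^A → ∞`), the pair system `(X, X)` breaks the
  stub with `pairwise_not_associated` deleted (`stubRoughZeroRepulsion_false_without_pairwise_of_roughLatticeZeros`).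

Numerics on record (item notes, 2026-08-15): `T_{(X,X)}(x) = 5.74 → 8.20`, `T_{X²}(x) = 4.25 → 6.04` for `x = 10³ → 10⁷`,
climbing, as the mechanism predicts (`≈ 2 log M(x)` from the lattice plus `4 log log P(x)` from the `E_p`-zeros).
-/

noncomputable section

open Polynomial Finset Complex

namespace Summit.Parity.BatemanHorn.Theorems.SystemZeroRepulsion.Negative

open Literature.NumberTheory.Sieve

/-! ## The pair system `(X, X)` satisfies every Bateman–Horn clause except `pairwise_not_associated` -/

/-- Members of `(X, X)` are irreducible. [folklore] -/
theorem pairXX_irreducible : ∀ i : Fin 2, Irreducible ((![X, X] : Fin 2 → ℤ[X]) i) := by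
  intro i
  fin_cases i <;> simpa using Polynomial.irreducible_X

/-- Members of `(X, X)` have positive leading coefficient. [folklore] -/
theorem pairXX_leadingCoeff_pos : ∀ i : Fin 2, 0 < ((![X, X] : Fin 2 → ℤ[X]) i).leadingCoeff := by
  intro i
  fin_cases i <;> simp

/-- `(X, X)` has no fixed prime divisor: `p ∣ n·n` with `0 ≤ n < p` forces `n = 0`, so `ω(p) ≤ 1 < p`. [folklore] -/
theorem pairXX_hasNoFixedPrimeDivisor : HasNoFixedPrimeDivisor (![X, X] : Fin 2 → ℤ[X]) := by
  intro p hp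
  unfold polyRootCountMod
  have hsub : ((Finset.range p).filter fun n : ℕ => (p : ℤ) ∣ ∏ i, ((![X, X] : Fin 2 → ℤ[X]) i).eval (n : ℤ)) ⊆
      {0} := by
    intro n hn
    simp only [Finset.mem_filter, Finset.mem_range, Fin.prod_univ_two, Matrix.cons_val_zero,
      Matrix.cons_val_one, eval_X] at hn
    obtain ⟨hnp, hdvd⟩ := hn
    have hpi : Prime (p : ℤ) := Nat.prime_iff_prime_int.mp hp
    have h1 : (p : ℤ) ∣ (n : ℤ) := by
      rcases hpi.dvd_or_dvd hdvd with h | h <;> exact h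
    have h3 : n = 0 := Nat.eq_zero_of_dvd_of_lt (Int.natCast_dvd_natCast.mp h1) hnp
    simp [h3]
  calc ((Finset.range p).filter fun n : ℕ => (p : ℤ) ∣ ∏ i, ((![X, X] : Fin 2 → ℤ[X]) i).eval (n : ℤ)).card
      ≤ ({0} : Finset ℕ).card := Finset.card_le_card hsub
    _ = 1 := Finset.card_singleton 0
    _ < p := hp.one_lt

/-- The exponent of the pair system is twice the capped statistic. [folklore] -/
theorem pairXX_exponent (n : ℕ) :
    (∑ i : Fin 2, ((((![X, X] : Fin 2 → ℤ[X]) i).eval (n : ℤ)).toNat.factorization.sum fun _ v => min v 2)) =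
      2 * (n.factorization.sum fun _ v => min v 2) := by
  simp [Fin.sum_univ_two, two_mul]

/-- `S_x(w) = P_x(w²)` for the pair system. [folklore] -/
theorem pairXX_eval (x : ℕ) (w : ℂ) :
    (∑ n ∈ Finset.range (x + 1), (X : ℂ[X]) ^
        (∑ i : Fin 2, ((((![X, X] : Fin 2 → ℤ[X]) i).eval (n : ℤ)).toNat.factorization.sum fun _ v => min v 2))).eval w =
      (∑ n ∈ Finset.range (x + 1), (X : ℂ[X]) ^ (n.factorization.sum fun _ v => min v 2)).eval (w ^ 2) := by
  simp only [pairXX_exponent, eval_finsetSum, eval_pow, eval_X, pow_mul]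

/-! ## The engine: lattice zeros of `P` force `T(S) ≥ (4/9) log(M+1)` whenever `S(w) = P(w²)` -/

/-- A polynomial `Σ_{n < N} X^{e n}` with `N ≠ 0` is non-zero (its value at `1` is `N`). [folklore] -/
theorem sum_range_X_pow_ne_zero (N : ℕ) (e : ℕ → ℕ) (hN : N ≠ 0) :
    (∑ n ∈ Finset.range N, (X : ℂ[X]) ^ (e n)) ≠ 0 := by
  intro h0
  have h1 := congrArg (Polynomial.eval (1 : ℂ)) h0
  simp only [eval_finsetSum, eval_pow, eval_X, one_pow, Finset.sum_const, Finset.card_range, nsmul_eq_mul,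
    mul_one, eval_zero, Nat.cast_eq_zero] at h1
  exact hN h1

/-- Parallelogram law at `1`: `‖1 − v‖² + ‖1 + v‖² = 2 + 2‖v‖²`. [folklore] -/
theorem norm_one_sub_sq_add_norm_one_add_sq (v : ℂ) : ‖1 - v‖ ^ 2 + ‖1 + v‖ ^ 2 = 2 + 2 * ‖v‖ ^ 2 := by
  simp only [Complex.sq_norm, Complex.normSq_sub, Complex.normSq_add, Complex.normSq_one]
  ring

/-- Every `ρ : ℂ` has a square root `w` with `‖1 − w‖² ≤ 1 + ‖ρ‖`. [folklore] -/
theorem exists_sq_root_near_one (ρ : ℂ) : ∃ w : ℂ, w ^ 2 = ρ ∧ ‖1 - w‖ ^ 2 ≤ 1 + ‖ρ‖ := by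
  obtain ⟨v, hv⟩ := IsAlgClosed.exists_pow_nat_eq ρ two_pos
  have hpar := norm_one_sub_sq_add_norm_one_add_sq v
  have hnorm : ‖v‖ ^ 2 = ‖ρ‖ := by rw [← norm_pow, hv]
  rcases le_or_gt (‖1 - v‖ ^ 2) (‖1 + v‖ ^ 2) with h | h
  · exact ⟨v, hv, by nlinarith [h, hpar, hnorm]⟩
  · refine ⟨-v, by rw [neg_sq, hv], ?_⟩
    rw [sub_neg_eq_add]
    nlinarith [h, hpar, hnorm]

/-- `Σ_{m=1}^{M} (m + 5/4)⁻¹ ≥ (4/9)·log(M+1)`. [folklore] -/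
theorem harmonic_shift_lower (M : ℕ) :
    (4 / 9 : ℝ) * Real.log ((M + 1 : ℕ) : ℝ) ≤ ∑ m ∈ Finset.Icc 1 M, ((m : ℝ) + 5 / 4)⁻¹ := by
  have hH : Real.log ((M + 1 : ℕ) : ℝ) ≤ ∑ m ∈ Finset.Icc 1 M, ((m : ℝ))⁻¹ := by
    have h := log_add_one_le_harmonic M
    simp only [harmonic_eq_sum_Icc, Rat.cast_sum, Rat.cast_inv, Rat.cast_natCast] at h
    exact h
  have hterm : ∀ m ∈ Finset.Icc 1 M, (4 / 9 : ℝ) * ((m : ℝ))⁻¹ ≤ ((m : ℝ) + 5 / 4)⁻¹ := by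
    intro m hm
    have hm1 : (1 : ℝ) ≤ m := by exact_mod_cast (Finset.mem_Icc.mp hm).1
    calc (4 / 9 : ℝ) * ((m : ℝ))⁻¹ = ((9 / 4 : ℝ) * m)⁻¹ := by rw [mul_inv]; norm_num
      _ ≤ ((m : ℝ) + 5 / 4)⁻¹ := inv_anti₀ (by linarith) (by linarith)
  calc (4 / 9 : ℝ) * Real.log ((M + 1 : ℕ) : ℝ) ≤ (4 / 9 : ℝ) * ∑ m ∈ Finset.Icc 1 M, ((m : ℝ))⁻¹ :=
        mul_le_mul_of_nonneg_left hH (by norm_num)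
    _ = ∑ m ∈ Finset.Icc 1 M, (4 / 9 : ℝ) * ((m : ℝ))⁻¹ := Finset.mul_sum _ _ _
    _ ≤ ∑ m ∈ Finset.Icc 1 M, ((m : ℝ) + 5 / 4)⁻¹ := Finset.sum_le_sum hterm

/-- **Engine.** If `S ≠ 0`, `S(w) = P(w²)` for all `w`, and `P` has a root within `1/4` of each of `−1, …, −M`, then
`T(S) = Σ_{ρ ∈ roots S} ‖1−ρ‖⁻² ≥ (4/9)·log(M+1)` (one square root of each lattice root, distinct, each `≥ (m+5/4)⁻¹`). [folklore] -/
theorem zeroFunctional_lower_of_latticeZeros (P S : ℂ[X]) (hSne : S ≠ 0)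
    (heval : ∀ w : ℂ, S.eval w = P.eval (w ^ 2)) (M : ℕ)
    (hroots : ∀ m : ℕ, 1 ≤ m → m ≤ M → ∃ ρ ∈ P.roots, ‖ρ + (m : ℂ)‖ ≤ 1 / 4) :
    (4 / 9 : ℝ) * Real.log ((M + 1 : ℕ) : ℝ) ≤ (S.roots.map (fun ρ : ℂ => (‖(1 : ℂ) - ρ‖ ^ 2)⁻¹)).sum := by
  have hρ' : ∀ m : ℕ, ∃ ρ : ℂ, (1 ≤ m ∧ m ≤ M) → (ρ ∈ P.roots ∧ ‖ρ + (m : ℂ)‖ ≤ 1 / 4) := by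
    intro m
    by_cases hm : 1 ≤ m ∧ m ≤ M
    · obtain ⟨ρ, hρ, hρm⟩ := hroots m hm.1 hm.2
      exact ⟨ρ, fun _ => ⟨hρ, hρm⟩⟩
    · exact ⟨0, fun h' => absurd h' hm⟩
  choose ρ hρ using hρ'
  have hw' : ∀ m : ℕ, ∃ w : ℂ, w ^ 2 = ρ m ∧ ‖1 - w‖ ^ 2 ≤ 1 + ‖ρ m‖ :=
    fun m => exists_sq_root_near_one (ρ m)
  choose w hw using hw'
  -- each `w m`, `1 ≤ m ≤ M`, is a root of `S`
  have hwroot : ∀ m ∈ Finset.Icc 1 M, w m ∈ S.roots := by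
    intro m hm
    obtain ⟨hρP, -⟩ := hρ m (Finset.mem_Icc.mp hm)
    refine Polynomial.mem_roots'.mpr ⟨hSne, ?_⟩
    rw [Polynomial.IsRoot, heval (w m), (hw m).1]
    exact (Polynomial.mem_roots'.mp hρP).2
  -- `m ↦ w m` is injective on `[1, M]`
  have hwinj : Set.InjOn w (Finset.Icc 1 M : Set ℕ) := by
    intro m hm m' hm' heq
    have hmm : ρ m = ρ m' := by rw [← (hw m).1, ← (hw m').1, heq]
    have h1 := (hρ m (Finset.mem_Icc.mp (by exact_mod_cast hm))).2
    have h2 := (hρ m' (Finset.mem_Icc.mp (by exact_mod_cast hm'))).2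
    by_contra hne
    have hdist : (1 : ℝ) ≤ ‖((m : ℂ)) - (m' : ℂ)‖ := by
      rw [show ((m : ℂ)) - (m' : ℂ) = (((m : ℤ) - (m' : ℤ) : ℤ) : ℂ) by push_cast; ring, Complex.norm_intCast]
      have hz : ((m : ℤ) - (m' : ℤ)) ≠ 0 := fun h0 => hne (by exact_mod_cast (sub_eq_zero.mp h0))
      exact_mod_cast Int.one_le_abs hz
    have htri : ‖((m : ℂ)) - (m' : ℂ)‖ ≤ ‖ρ m + (m : ℂ)‖ + ‖ρ m' + (m' : ℂ)‖ := by
      rw [show ((m : ℂ)) - (m' : ℂ) = (ρ m + (m : ℂ)) - (ρ m' + (m' : ℂ)) by rw [hmm]; ring]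
      exact norm_sub_le _ _
    linarith
  -- the distinct roots `w m` contribute at least `Σ (m + 5/4)⁻¹`
  set g : ℂ → ℝ := fun r => (‖(1 : ℂ) - r‖ ^ 2)⁻¹ with hg
  have hg0 : ∀ r, 0 ≤ g r := fun r => by rw [hg]; positivity
  have hF : ((Finset.Icc 1 M).image w).val ≤ S.roots := by
    rw [Multiset.le_iff_subset ((Finset.Icc 1 M).image w).nodup]
    intro r hr
    obtain ⟨m, hm, rfl⟩ := Finset.mem_image.mp (Finset.mem_val.mp hr)
    exact hwroot m hm
  have hTlower : ∑ m ∈ Finset.Icc 1 M, g (w m) ≤ (S.roots.map g).sum := by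
    calc ∑ m ∈ Finset.Icc 1 M, g (w m) = ∑ r ∈ (Finset.Icc 1 M).image w, g r :=
          (Finset.sum_image hwinj).symm
      _ = ((((Finset.Icc 1 M).image w).val).map g).sum := Finset.sum_eq_multiset_sum _ _
      _ ≤ (S.roots.map g).sum := by
          obtain ⟨t, ht⟩ := Multiset.le_iff_exists_add.mp hF
          rw [ht, Multiset.map_add, Multiset.sum_add]
          have : 0 ≤ (t.map g).sum := Multiset.sum_nonneg (fun v hv => by
            obtain ⟨r, _, rfl⟩ := Multiset.mem_map.mp hv
            exact hg0 r)
          linarith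
  have hterm : ∀ m ∈ Finset.Icc 1 M, ((m : ℝ) + 5 / 4)⁻¹ ≤ g (w m) := by
    intro m hm
    have hρm := (hρ m (Finset.mem_Icc.mp hm)).2
    have hnormρ : ‖ρ m‖ ≤ (m : ℝ) + 1 / 4 := by
      calc ‖ρ m‖ = ‖ρ m + (m : ℂ) - (m : ℂ)‖ := by rw [add_sub_cancel_right]
        _ ≤ ‖ρ m + (m : ℂ)‖ + ‖((m : ℂ))‖ := norm_sub_le _ _
        _ ≤ (m : ℝ) + 1 / 4 := by rw [Complex.norm_natCast]; linarith
    have hup : ‖(1 : ℂ) - w m‖ ^ 2 ≤ (m : ℝ) + 5 / 4 := by linarith [(hw m).2]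
    have hpos : 0 < ‖(1 : ℂ) - w m‖ ^ 2 := by
      have hne1 : w m ≠ 1 := by
        intro h1
        have hρ1 : ρ m = 1 := by rw [← (hw m).1, h1, one_pow]
        rw [hρ1, show (1 : ℂ) + (m : ℂ) = ((m + 1 : ℕ) : ℂ) by push_cast; ring, Complex.norm_natCast] at hρm
        have : (1 : ℝ) ≤ ((m + 1 : ℕ) : ℝ) := by exact_mod_cast Nat.succ_le_succ (Nat.zero_le m)
        linarith
      have : (1 : ℂ) - w m ≠ 0 := sub_ne_zero.mpr (Ne.symm hne1)
      positivity
    exact inv_anti₀ hpos hup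
  calc (4 / 9 : ℝ) * Real.log ((M + 1 : ℕ) : ℝ) ≤ ∑ m ∈ Finset.Icc 1 M, ((m : ℝ) + 5 / 4)⁻¹ :=
        harmonic_shift_lower M
    _ ≤ ∑ m ∈ Finset.Icc 1 M, g (w m) := Finset.sum_le_sum hterm
    _ ≤ (S.roots.map g).sum := hTlower

/-- A lattice depth `M(C)` with `(4/9)·log(M+1) > C`. [folklore] -/
theorem exists_depth_gt (C : ℝ) : ∃ M : ℕ, C < (4 / 9 : ℝ) * Real.log ((M + 1 : ℕ) : ℝ) := by
  refine ⟨⌈Real.exp ((9 / 4) * (|C| + 1))⌉₊, ?_⟩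
  set M : ℕ := ⌈Real.exp ((9 / 4) * (|C| + 1))⌉₊ with hM
  have h1 : Real.exp ((9 / 4) * (|C| + 1)) ≤ (M : ℝ) := Nat.le_ceil _
  have h2 : (M : ℝ) < ((M + 1 : ℕ) : ℝ) := by push_cast; linarith
  have h3 : (9 / 4) * (|C| + 1) < Real.log ((M + 1 : ℕ) : ℝ) := by
    rw [← Real.log_exp ((9 / 4) * (|C| + 1))]
    exact Real.log_lt_log (Real.exp_pos _) (lt_of_le_of_lt h1 h2)
  have h4 : C ≤ |C| := le_abs_self C
  nlinarith

/-! ## `pairwise_not_associated` is load-bearing (witness `(X, X)`) -/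

/-- **`pairwise_not_associated` is load-bearing for `SystemZeroRepulsion`, modulo the lattice zeros of `P_x`.**
Hypothesis (LZ): for every `M` there is `x ≥ 2` such that the `f = X` polynomial `P_x = Σ_{n≤x} X^{s(n)}` has a root within
`1/4` of each of `−1, …, −M` (Selberg–Delange uniform on `|z| ≤ M+1` plus Hurwitz; true for all large `x`, not yet in the
tree).  Conclusion: the crux with the clause `pairwise_not_associated` deleted from `IsBatemanHornSystem` is false — the pair
system `(X, X)` has `T_{(X,X)}(x) ≥ Σ_{m ≤ M} (m + 5/4)⁻¹ ≥ (4/9) log(M+1)` at the `x` supplied by (LZ). [folklore] -/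
theorem systemZeroRepulsion_false_without_pairwise_of_latticeZeros
    (hLZ : ∀ M : ℕ, ∃ x : ℕ, 2 ≤ x ∧ ∀ m : ℕ, 1 ≤ m → m ≤ M →
      ∃ ρ ∈ (∑ n ∈ Finset.range (x + 1), (X : ℂ[X]) ^ (n.factorization.sum fun _ v => min v 2)).roots,
        ‖ρ + (m : ℂ)‖ ≤ 1 / 4) :
    ¬ (∀ (k : ℕ) (f : Fin k → ℤ[X]), (∀ i, Irreducible (f i)) → (∀ i, 0 < (f i).leadingCoeff) →
        HasNoFixedPrimeDivisor f → ∃ C : ℝ, ∀ x : ℕ, 2 ≤ x →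
          ((∑ n ∈ Finset.range (x + 1), (Polynomial.X : Polynomial ℂ) ^
              (∑ i, (((f i).eval (n : ℤ)).toNat.factorization.sum fun _ v => min v 2))).roots.map
            (fun ρ : ℂ => (‖(1 : ℂ) - ρ‖ ^ 2)⁻¹)).sum ≤ C) := by
  intro h
  obtain ⟨C, hC⟩ := h 2 ![X, X] pairXX_irreducible pairXX_leadingCoeff_pos pairXX_hasNoFixedPrimeDivisor
  obtain ⟨M, hlogM⟩ := exists_depth_gt C
  obtain ⟨x, hx2, hroots⟩ := hLZ M
  have hlow := zeroFunctional_lower_of_latticeZeros _ _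
    (sum_range_X_pow_ne_zero (x + 1) _ (Nat.succ_ne_zero x)) (pairXX_eval x) M hroots
  have hTx := hC x hx2
  linarith

/-! ## `irreducible` is load-bearing (witness `X²`; v2) -/

/-- `X²` has positive leading coefficient. [folklore] -/
theorem sqX_leadingCoeff_pos : ∀ i : Fin 1, 0 < ((![X ^ 2] : Fin 1 → ℤ[X]) i).leadingCoeff := by
  intro i
  fin_cases i
  simp

/-- A one-member family is pairwise non-associated (vacuously). [folklore] -/
theorem sqX_pairwise : Pairwise fun i j : Fin 1 => ¬Associated ((![X ^ 2] : Fin 1 → ℤ[X]) i) ((![X ^ 2]) j) :=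
  fun i j hij => absurd (Subsingleton.elim i j) hij

/-- `X²` has no fixed prime divisor: `p ∣ n²` with `0 ≤ n < p` forces `n = 0`. [folklore] -/
theorem sqX_hasNoFixedPrimeDivisor : HasNoFixedPrimeDivisor (![X ^ 2] : Fin 1 → ℤ[X]) := by
  intro p hp
  unfold polyRootCountMod
  have hsub : ((Finset.range p).filter fun n : ℕ => (p : ℤ) ∣ ∏ i, ((![X ^ 2] : Fin 1 → ℤ[X]) i).eval (n : ℤ)) ⊆
      {0} := by
    intro n hn
    simp only [Finset.mem_filter, Finset.mem_range, Fin.prod_univ_one, Matrix.cons_val_fin_one, eval_pow,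
      eval_X] at hn
    obtain ⟨hnp, hdvd⟩ := hn
    have h1 : (p : ℤ) ∣ (n : ℤ) := (Nat.prime_iff_prime_int.mp hp).dvd_of_dvd_pow hdvd
    have h3 : n = 0 := Nat.eq_zero_of_dvd_of_lt (Int.natCast_dvd_natCast.mp h1) hnp
    simp [h3]
  calc ((Finset.range p).filter fun n : ℕ => (p : ℤ) ∣ ∏ i, ((![X ^ 2] : Fin 1 → ℤ[X]) i).eval (n : ℤ)).card
      ≤ ({0} : Finset ℕ).card := Finset.card_le_card hsub
    _ = 1 := Finset.card_singleton 0
    _ < p := hp.one_lt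

/-- The exponent of the family `![X²]` is `2·ω(n)` (`capped_sq`: the capped statistic of a square). [folklore] -/
theorem sqX_exponent (n : ℕ) :
    (∑ i : Fin 1, ((((![X ^ 2] : Fin 1 → ℤ[X]) i).eval (n : ℤ)).toNat.factorization.sum fun _ v => min v 2)) =
      2 * n.primeFactors.card := by
  have h : (((X ^ 2 : ℤ[X])).eval (n : ℤ)).toNat = n ^ 2 := by
    simp only [eval_pow, eval_X]
    exact_mod_cast Int.toNat_natCast (n ^ 2)
  simp only [Fin.sum_univ_one, Matrix.cons_val_fin_one, h,
    Summit.Parity.BatemanHorn.Theorems.SystemLSDRealSegment.Negative.capped_sq]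

/-- `S_x(w) = W_x(w²)` for the family `![X²]`. [folklore] -/
theorem sqX_eval (x : ℕ) (w : ℂ) :
    (∑ n ∈ Finset.range (x + 1), (X : ℂ[X]) ^
        (∑ i : Fin 1, ((((![X ^ 2] : Fin 1 → ℤ[X]) i).eval (n : ℤ)).toNat.factorization.sum fun _ v => min v 2))).eval w =
      (∑ n ∈ Finset.range (x + 1), (X : ℂ[X]) ^ (n.primeFactors.card)).eval (w ^ 2) := by
  simp only [sqX_exponent, eval_finsetSum, eval_pow, eval_X, pow_mul]

/-- **`irreducible` is load-bearing for `SystemZeroRepulsion`, modulo the lattice zeros of `W_x = Σ_{n≤x} X^{ω(n)}`.**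
Hypothesis (LZω): for every `M` there is `x ≥ 2` such that `W_x` has a root within `1/4` of each of `−1, …, −M` (Selberg's
theorem uniform on `|z| ≤ M+1` plus Hurwitz; true for all large `x`, not yet in the tree).  Conclusion: the crux with the
clause `irreducible` deleted from `IsBatemanHornSystem` is false — the family `![X²]` has `S_x(w) = W_x(w²)` and
`T_{X²}(x) ≥ (4/9) log(M+1)` at the `x` supplied by (LZω). [folklore] -/
theorem systemZeroRepulsion_false_without_irreducible_of_latticeZerosOmega
    (hLZ : ∀ M : ℕ, ∃ x : ℕ, 2 ≤ x ∧ ∀ m : ℕ, 1 ≤ m → m ≤ M →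
      ∃ ρ ∈ (∑ n ∈ Finset.range (x + 1), (X : ℂ[X]) ^ (n.primeFactors.card)).roots, ‖ρ + (m : ℂ)‖ ≤ 1 / 4) :
    ¬ (∀ (k : ℕ) (f : Fin k → ℤ[X]), (∀ i, 0 < (f i).leadingCoeff) →
        (Pairwise fun i j => ¬Associated (f i) (f j)) → HasNoFixedPrimeDivisor f → ∃ C : ℝ, ∀ x : ℕ, 2 ≤ x →
          ((∑ n ∈ Finset.range (x + 1), (Polynomial.X : Polynomial ℂ) ^
              (∑ i, (((f i).eval (n : ℤ)).toNat.factorization.sum fun _ v => min v 2))).roots.map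
            (fun ρ : ℂ => (‖(1 : ℂ) - ρ‖ ^ 2)⁻¹)).sum ≤ C) := by
  intro h
  obtain ⟨C, hC⟩ := h 1 ![X ^ 2] sqX_leadingCoeff_pos sqX_pairwise sqX_hasNoFixedPrimeDivisor
  obtain ⟨M, hlogM⟩ := exists_depth_gt C
  obtain ⟨x, hx2, hroots⟩ := hLZ M
  have hlow := zeroFunctional_lower_of_latticeZeros _ _
    (sum_range_X_pow_ne_zero (x + 1) _ (Nat.succ_ne_zero x)) (sqX_eval x) M hroots
  have hTx := hC x hx2
  linarith

/-! ## v3: the same lever on the line stub `stub_roughZeroRepulsion` (euler-species-factorisation, l.214) -/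

/-- The rough statistic of the pair system is twice that of `f = X`. [folklore] -/
theorem pairXX_roughStat (y n : ℕ) :
    (∑ i : Fin 2, ((((![X, X] : Fin 2 → ℤ[X]) i).eval (n : ℤ)).toNat.factorization.sum
        fun p v => if y < p then min v 2 else 0)) =
      2 * (n.factorization.sum fun p v => if y < p then min v 2 else 0) := by
  simp [Fin.sum_univ_two, two_mul]

/-- `R^{(X,X)}_{x,y}(w) = R^X_{x,y}(w²)`. [folklore] -/
theorem pairXX_rough_eval (x y : ℕ) (w : ℂ) :
    (∑ n ∈ Finset.range (x + 1), (X : ℂ[X]) ^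
        (∑ i : Fin 2, ((((![X, X] : Fin 2 → ℤ[X]) i).eval (n : ℤ)).toNat.factorization.sum
          fun p v => if y < p then min v 2 else 0))).eval w =
      (∑ n ∈ Finset.range (x + 1), (X : ℂ[X]) ^
        (n.factorization.sum fun p v => if y < p then min v 2 else 0)).eval (w ^ 2) := by
  simp only [pairXX_roughStat, eval_finsetSum, eval_pow, eval_X, pow_mul]

/-- **`pairwise_not_associated` is load-bearing for `stub_roughZeroRepulsion`, modulo the rough lattice zeros (RLZ).**
The stub (ESF skeleton l.214) inlined: `cutoff A x = ⌊exp(log x/(log log x)^A)⌋₊`, `T(R) = Σ_{ρ ∈ roots R} ‖1−ρ‖⁻²`. -/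
theorem stubRoughZeroRepulsion_false_without_pairwise_of_roughLatticeZeros
    (hRLZ : ∀ A : ℕ, 1 ≤ A → ∀ M x₀ : ℕ, ∃ x : ℕ, x₀ ≤ x ∧ ∀ m : ℕ, 1 ≤ m → m ≤ M →
      ∃ ρ ∈ (∑ n ∈ Finset.range (x + 1), (X : ℂ[X]) ^
        (n.factorization.sum fun p v =>
          if ⌊Real.exp (Real.log (x : ℝ) / (Real.log (Real.log (x : ℝ))) ^ A)⌋₊ < p then min v 2 else 0)).roots,
        ‖ρ + (m : ℂ)‖ ≤ 1 / 4) :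
    ¬ (∀ (k : ℕ) (f : Fin k → ℤ[X]), (∀ i, Irreducible (f i)) → (∀ i, 0 < (f i).leadingCoeff) →
        HasNoFixedPrimeDivisor f →
        ∃ A₁ : ℕ, ∀ A : ℕ, A₁ ≤ A → ∃ C : ℝ, ∃ x₀ : ℕ, ∀ x : ℕ, x₀ ≤ x →
          ((∑ n ∈ Finset.range (x + 1), (Polynomial.X : Polynomial ℂ) ^
              (∑ i, (((f i).eval (n : ℤ)).toNat.factorization.sum fun p v =>
                if ⌊Real.exp (Real.log (x : ℝ) / (Real.log (Real.log (x : ℝ))) ^ A)⌋₊ < p then min v 2 else 0))).roots.map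
            (fun ρ : ℂ => (‖(1 : ℂ) - ρ‖ ^ 2)⁻¹)).sum ≤ C) := by
  intro h
  obtain ⟨A₁, hA₁⟩ := h 2 ![X, X] pairXX_irreducible pairXX_leadingCoeff_pos pairXX_hasNoFixedPrimeDivisor
  obtain ⟨C, x₀, hC⟩ := hA₁ (max A₁ 1) (le_max_left _ _)
  obtain ⟨M, hlogM⟩ := exists_depth_gt C
  obtain ⟨x, hx0, hroots⟩ := hRLZ (max A₁ 1) (le_max_right _ _) M x₀
  have hlow := zeroFunctional_lower_of_latticeZeros _ _
    (sum_range_X_pow_ne_zero (x + 1) _ (Nat.succ_ne_zero x))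
    (pairXX_rough_eval x (⌊Real.exp (Real.log (x : ℝ) / (Real.log (Real.log (x : ℝ))) ^ (max A₁ 1))⌋₊)) M hroots
  have hTx := hC x hx0
  linarith

end Summit.Parity.BatemanHorn.Theorems.SystemZeroRepulsion.Negative
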